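import Literature.NumberTheory.EllipticCurves.NewformsStrongMultiplicityOneProofs
import HarnessLib

/-!
# An eigenform with the packet of a newform `g₀` is a combination of the `g₀(dτ)`, `d ∣ L/M`

A `…Proofs` companion (theorems only: no definition, no named fact, no instance; D-0026) of
`Literature.NumberTheory.EllipticCurves.Newforms` / `NewformsStrongMultiplicityOne`.

Let `h ∈ S_k(Γ₀(L))` be an eigenvector of the Hecke operators `T_p`, `p ∤ L`, with eigenvalues
`a_p(g₀)` for a newform `g₀ ∈ S_k(Γ₀(M))`, `M ∣ L`.  Then

  `h = ∑_{d ∣ L/M} c_d · g₀(dτ)`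

for some scalars `c_d` (`mem_span_degeneracyMap0_of_eigenpacket`, `exists_cuspCoeff_eq_sum_of_eigenpacket`):
the `{T_p : p ∤ L}`-isotypic component of `S_k(Γ₀(L))` attached to the packet of `g₀` is spanned by the
degeneracy images `[α_d]_k g₀`, `M d ∣ L`.  This is the consequence of the Atkin–Lehner decomposition
`S_k(Γ₀(L)) = ⊕_{M ∣ L} ⊕_{d ∣ L/M} S_k(Γ₀(M))^{new}(dτ)` (Atkin–Lehner 1970, Thm. 5; Diamond–Shurman
Thm. 5.8.3; Cohen 2019, §6.4) and of strong multiplicity one (Atkin–Lehner 1970, Thm. 4) that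
Diamond–Shurman record as Exercise 5.8.4 / the discussion after Thm. 5.8.3 ("the set of `f(nτ)` … is a
basis … each `f(nτ)` lies in the eigenspace of `f`").  Here it is PROVED from the tree's theorems: the
spanning half `iSup_atkinLehnerComponent_eq_top` with the newform bases `span_newforms0_holds`, the
independence of the joint generalised eigenspaces of `{T_p : p ∤ L}`
(`iSupIndep_iInf_maxGenEigenspace_heckeT_off_level`), `degeneracyMap0_mem_iInf_maxGenEigenspace`, and
strong multiplicity one across levels (`IsNewform0.level_eq_of_heckeEigenvalue_eq_holds`,
`IsNewform0.eq_of_heckeEigenvalue_eq_holds`).  The coefficient form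
`aₙ(h) = ∑_{d ∣ L/M} c_d 𝟙_{d ∣ n} a_{n/d}(g₀)` (`exists_cuspCoeff_eq_sum_of_eigenpacket`) is what the
twisting theorems of `NewformsTwistNewProofs` consume.

## References

* [AtkinLehner1970] A. O. L. Atkin, J. Lehner, *Hecke operators on `Γ₀(m)`*, Math. Ann. 185 (1970),
  134–160, Thms. 4, 5.
* [DiamondShurman2005] F. Diamond, J. Shurman, *A first course in modular forms*, GTM 228 (2005),
  Thm. 5.8.3 and its proof (PDF pp. 216–219), §5.7 (`ι_d` on Fourier expansions).
* [Cohen2019] H. Cohen, *An introduction to modular forms*, in: Notes from the International Autumn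
  School on Computational Number Theory, Birkhäuser 2019, §6.4.
-/

noncomputable section

open scoped MatrixGroups ModularForm

open CongruenceSubgroup UpperHalfPlane

namespace Literature.NumberTheory.EllipticCurves.ModularForms

variable {L : ℕ} [NeZero L] {k : ℤ}

omit [NeZero L] in
/-- Divisors `d` of `L / M` give Atkin–Lehner parameters: `M d ∣ L` (for `M ∣ L`). [folklore] -/
theorem mul_dvd_of_mem_divisors_div {M d : ℕ} (hML : M ∣ L) (hd : d ∈ (L / M).divisors) :
    M * d ∣ L :=
  Nat.mul_dvd_of_dvd_div hML (Nat.dvd_of_mem_divisors hd)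

omit [NeZero L] in
/-- A divisor of `L / M` is non-zero (as a `NeZero` fact, to form `[α_d]_k`). [folklore] -/
theorem neZero_of_mem_divisors_div {M d : ℕ} (hd : d ∈ (L / M).divisors) : NeZero d :=
  ⟨Nat.pos_iff_ne_zero.mp (Nat.pos_of_mem_divisors hd)⟩

/-- **An eigenform with a newform's packet lies in the span of that newform's degeneracy images**
(Atkin–Lehner 1970, Thm. 5 with Thm. 4; Diamond–Shurman Thm. 5.8.3 and the remarks following it).
Let `g₀ ∈ S_k(Γ₀(M))` be a newform, `M ∣ L`, and `h ∈ S_k(Γ₀(L))` with `T_p h = a_p(g₀) h` for every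
prime `p ∤ L`.  Then `h` lies in the span of the `[α_d]_k g₀ = d^{k-1} g₀(dτ)`, `d ∣ L/M`.  Proof: the
degeneracy images `[α_d]_k g` of ALL newforms `g` of the levels `M' ∣ L` span `S_k(Γ₀(L))`
(`iSup_atkinLehnerComponent_eq_top`, `span_newforms0_holds`) and lie in the joint generalised
eigenspaces `V(θ_g)` of `{T_p : p ∤ L}` for the packets `θ_g = (a_p(g))_{p ∤ L}`
(`degeneracyMap0_mem_iInf_maxGenEigenspace`), which are independent for distinct packets
(`iSupIndep_iInf_maxGenEigenspace_heckeT_off_level`); by strong multiplicity one the only newform with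
the packet of `g₀` is `g₀` itself (`IsNewform0.level_eq_of_heckeEigenvalue_eq_holds`,
`IsNewform0.eq_of_heckeEigenvalue_eq_holds`), so `S_k(Γ₀(L)) = A + B` with `A` the span of the
`[α_d]_k g₀` (`⊆ V(θ_{g₀})`) and `B ⊆ ⨆_{θ ≠ θ_{g₀}} V(θ)`; writing `h = a + b`, `b = h - a ∈ V(θ_{g₀}) ∩ B = 0`.
[cite: DiamondShurman2005, Thm. 5.8.3 (and proof, PDF pp. 216–219)] [cite: AtkinLehner1970, Thm. 5] -/
theorem mem_span_degeneracyMap0_of_eigenpacket {M : ℕ} [NeZero M] (hML : M ∣ L)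
    {g₀ : CuspForm (Gamma0 M) k} (hg₀ : IsNewform0 g₀) {h : CuspForm (Gamma0 L) k}
    (hT : ∀ (p : ℕ) (hp : p.Prime), ¬ p ∣ L →
      (haveI : NeZero p := ⟨hp.ne_zero⟩; heckeT (Gamma0 L) k p h) = cuspCoeff g₀ p • h) :
    h ∈ Submodule.span ℂ (Set.range fun d : {d : ℕ // d ∈ (L / M).divisors} ↦
      (haveI : NeZero d.1 := neZero_of_mem_divisors_div d.2;
        degeneracyMap0 M L d.1 k g₀)) := by
  classical
  -- the commuting family `{T_p : p ∤ L}` and its joint generalised eigenspaces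
  let I : Type := {p : ℕ // p.Prime ∧ ¬ p ∣ L}
  let V : (I → ℂ) → Submodule ℂ (CuspForm (Gamma0 L) k) := fun θ ↦
    ⨅ p : I, Module.End.maxGenEigenspace
      (haveI : NeZero p.1 := ⟨p.2.1.ne_zero⟩; heckeT (Gamma0 L) k p.1) (θ p)
  have hind : iSupIndep V := iSupIndep_iInf_maxGenEigenspace_heckeT_off_level L k
  -- the packet of `g₀`
  let θ₀ : I → ℂ := fun p ↦ heckeEigenvalue g₀ p.1
  have hθ₀ : ∀ p : I, θ₀ p = cuspCoeff g₀ p.1 := fun p ↦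
    heckeEigenvalue_eq_coeff_of_isNormalized hg₀.2.2 p.2.1 (hg₀.2.1 p.1 p.2.1)
  have hhV : h ∈ V θ₀ := by
    refine (Submodule.mem_iInf _).mpr fun p ↦ Module.End.eigenspace_le_maxGenEigenspace ?_
    rw [Module.End.mem_eigenspace_iff, hθ₀ p]
    exact hT p.1 p.2.1 p.2.2
  -- `A`: the span of the `[α_d]_k g₀`; it lies in `V θ₀`
  set A : Submodule ℂ (CuspForm (Gamma0 L) k) := Submodule.span ℂ (Set.range
    fun d : {d : ℕ // d ∈ (L / M).divisors} ↦
      (haveI : NeZero d.1 := neZero_of_mem_divisors_div d.2; degeneracyMap0 M L d.1 k g₀)) with hA_def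
  have hAV : A ≤ V θ₀ := by
    rw [hA_def, Submodule.span_le]
    rintro _ ⟨d, rfl⟩
    haveI : NeZero d.1 := neZero_of_mem_divisors_div d.2
    exact degeneracyMap0_mem_iInf_maxGenEigenspace (mul_dvd_of_mem_divisors_div hML d.2) hg₀
  -- `B`: the other joint eigenspaces
  let S : Set (I → ℂ) := {θ₀}ᶜ
  have htop : (⊤ : Submodule ℂ (CuspForm (Gamma0 L) k)) ≤ A ⊔ ⨆ θ ∈ S, V θ := by
    rw [← iSup_atkinLehnerComponent_eq_top k L]
    refine iSup_le fun x ↦ ?_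
    rw [atkinLehnerComponent, ← span_newforms0_holds x.1.1 k, Submodule.map_span,
      Submodule.span_le]
    rintro _ ⟨g, hg, rfl⟩
    have hg' : IsNewform0 g := hg
    by_cases hθ : (fun p : I ↦ heckeEigenvalue g p.1) = θ₀
    · -- same packet: `g` is `g₀` (strong multiplicity one), and `[α_d]_k g₀ ∈ A`
      have hfin : {p : ℕ | p.Prime ∧ heckeEigenvalue g p ≠ heckeEigenvalue g₀ p}.Finite := by
        refine (Finset.finite_toSet L.divisors).subset ?_
        rintro p ⟨hp, hne⟩
        rw [Finset.mem_coe, Nat.mem_divisors]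
        refine ⟨by_contra fun hpL ↦ hne ?_, NeZero.ne L⟩
        exact congr_fun hθ ⟨p, hp, hpL⟩
      have hMx : x.1.1 = M := IsNewform0.level_eq_of_heckeEigenvalue_eq_holds hg' hg₀ hfin
      obtain ⟨⟨M', d⟩, hx⟩ := x
      simp only at hMx hg hg' hfin hθ hx ⊢
      subst M'
      have hgg : g = g₀ := IsNewform0.eq_of_heckeEigenvalue_eq_holds hg' hg₀ hfin
      subst g
      have hd : d ∈ (L / M).divisors := by
        rw [Nat.mem_divisors]
        exact ⟨Nat.dvd_div_of_mul_dvd hx,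
          (Nat.div_pos (Nat.le_of_dvd (NeZero.pos L) hML) (NeZero.pos _)).ne'⟩
      refine Submodule.mem_sup_left (Submodule.subset_span ⟨⟨d, hd⟩, ?_⟩)
      rfl
    · -- a different packet: the image lies in `V θ_g ≤ ⨆_{θ ≠ θ₀} V θ`
      have hmem : degeneracyMap0 x.1.1 L x.1.2 k g ∈ V (fun p : I ↦ heckeEigenvalue g p.1) :=
        degeneracyMap0_mem_iInf_maxGenEigenspace x.2 hg'
      exact Submodule.mem_sup_right ((le_biSup V (show _ ∈ S from hθ)) hmem)
  -- decompose `h = a + b`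
  have hdis : Disjoint (V θ₀) (⨆ θ ∈ S, V θ) := hind.disjoint_biSup (fun h0 ↦ h0 rfl)
  obtain ⟨a, haA, b, hbB, hab⟩ := Submodule.mem_sup.mp (htop (Submodule.mem_top (x := h)))
  have hbV : b ∈ V θ₀ := by
    have : b = h - a := by rw [← hab]; abel
    rw [this]
    exact Submodule.sub_mem _ hhV (hAV haA)
  have hb0 : b = 0 := (Submodule.disjoint_def.mp hdis) b hbV hbB
  rw [← hab, hb0, add_zero]
  exact haA

/-- **Coefficient form**: with `g₀`, `h` as in `mem_span_degeneracyMap0_of_eigenpacket` there are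
scalars `c_d` with `aₙ(h) = ∑_{d ∣ L/M} c_d · 𝟙_{d ∣ n} · a_{n/d}(g₀)` for every `n` — the Fourier
expansion of `h = ∑_d c_d g₀(dτ)` (Diamond–Shurman §5.7, `ι_d` on Fourier expansions:
`qExpansion_coeff_iota`, `degeneracyMap0_eq_smul_iota`; the factor `d^{k-1}` of `[α_d]_k = d^{k-1} ι_d`
is absorbed in `c_d`). [cite: DiamondShurman2005, Thm. 5.8.3 and §5.7] -/
theorem exists_cuspCoeff_eq_sum_of_eigenpacket {M : ℕ} [NeZero M] (hML : M ∣ L)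
    {g₀ : CuspForm (Gamma0 M) k} (hg₀ : IsNewform0 g₀) {h : CuspForm (Gamma0 L) k}
    (hT : ∀ (p : ℕ) (hp : p.Prime), ¬ p ∣ L →
      (haveI : NeZero p := ⟨hp.ne_zero⟩; heckeT (Gamma0 L) k p h) = cuspCoeff g₀ p • h) :
    ∃ c : ℕ → ℂ, ∀ n : ℕ, cuspCoeff h n =
      ∑ d ∈ (L / M).divisors, c d * (if d ∣ n then cuspCoeff g₀ (n / d) else 0) := by
  classical
  have hmem := mem_span_degeneracyMap0_of_eigenpacket hML hg₀ hT
  obtain ⟨c, hc⟩ := (Submodule.mem_span_range_iff_exists_fun ℂ).mp hmem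
  -- the coefficients, with the factor `d^{k-1}` of `[α_d]_k = d^{k-1} ι_d` absorbed
  let c' : ℕ → ℂ := fun d ↦ if hd : d ∈ (L / M).divisors then c ⟨d, hd⟩ * (d : ℂ) ^ (k - 1) else 0
  have hterm : ∀ (d : {d : ℕ // d ∈ (L / M).divisors}) (n : ℕ),
      cuspCoeff (c d • (haveI : NeZero d.1 := neZero_of_mem_divisors_div d.2;
        degeneracyMap0 M L d.1 k g₀)) n =
        c' d.1 * (if d.1 ∣ n then cuspCoeff g₀ (n / d.1) else 0) := by
    intro d n
    haveI : NeZero d.1 := neZero_of_mem_divisors_div d.2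
    have hc' : c' d.1 = c d * (d.1 : ℂ) ^ (k - 1) := by
      simp only [c', dif_pos d.2, Subtype.coe_eta]
    rw [hc', cuspCoeff, qExpansion_coeff_smul,
      degeneracyMap0_eq_smul_iota M L d.1 k (mul_dvd_of_mem_divisors_div hML d.2),
      qExpansion_coeff_smul, qExpansion_coeff_iota]
    simp only [cuspCoeff, mul_assoc]
  refine ⟨c', fun n ↦ ?_⟩
  have hcoe := congrArg (fun u : CuspForm (Gamma0 L) k ↦ cuspCoeff u n) hc
  rw [← hcoe, cuspCoeff, qExpansion_coeff_finset_sum, ← Finset.sum_coe_sort (L / M).divisors]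
  exact Finset.sum_congr rfl fun d _ ↦ hterm d n

end Literature.NumberTheory.EllipticCurves.ModularForms

end
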